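/-
Copyright (c) 2026 the pub-hodgecm-mathlib formalisation cell (harness21).  Prover seat hodgecm-mathlib-K2E1-p15 (g4) ((V) OF RECORD KEEPER from ED. 14, S8-R249 ∕ S8-R252; ED. 9–13 by R90-C133-p02 (g2), ED. 2–8 by K2E1-p16
(g3) ∕ K2E1-p15 (g4); Track B ∕ K2-LIT), h413 = `stmt-HodgeConjecture-24833`, R90-TF section S8 «ContSpec-n½», socket B MID :358 «(V) OF RECORD ED. 16»: the SEQUEL of ★ p865134 (ED. 15)
`resGMidBlock_ne_bot_of_record_v15` with the BASIS BINDERS `{ι'} [Fintype ι'] [DecidableEq ι'] bV hbc {Mb} hbM` DISCHARGED BY NAME — ★ p865115 `exists_blockBasis_levelOfRecord` (K2E1-p13 (g6)) —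
and, since the basis is now chosen INSIDE the proof, the source letter `hsrc` restated BASIS-FREE at the base point (`(∫_N f_z(w₀vg₁))·H(g₁)^{z−2}·Θ(g₁) = A(z)·cS(z)`, the shape of its payer
★ p864589), the coordinate form of ED. 12–15 being recovered from the exports' clause 2 at `g₁` (`ν 𝓕 = 1`).
-/
import Summits.HodgeConjecture.HodgeConjecture.Theorems.R90S8ResGMidBlockNeBotOfRecordV15U3     -- ★ p865134 (this seat): (V) OF RECORD ED. 15 `resGMidBlock_ne_bot_of_record_v15`
import Summits.HodgeConjecture.HodgeConjecture.Theorems.R90S8MidWitnessLevelBlockBasisU3         -- ★ p865115 (K2E1-p13 (g6)): `exists_blockBasis_levelOfRecord` — the `bV hbc hbM` binders, letter-free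
import HarnessLib

/-!
# S8 socket B MID — `R90S8ResGMidBlockNeBotOfRecordV16U3` ((V) OF RECORD, ED. 16): `LHalfNeZero (ξ.bcη⁻¹·μω) → resGMidBlock L μ ξ μω ≠ ⊥` AT THE LEVEL OF RECORD — ED. 15 with
# the BASIS `bV hbc hbM` DISCHARGED (★ p865115) and `hsrc` BASIS-FREE; visible letters now: `hunfK` (the (W)-core's readings), the frame extras `μK νI 𝓕I h𝓕I h𝓕1`, the witness
# `φ₀ hφ₀V hφ₀c hφ₀M`, the base point `g₁`, `hsrc` with its constants `S₀ C hC ε hε1 hε0 kμ hk δ d νv μE₁ μF₁`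

Track B ∕ K2-LIT, crux h413 = `stmt-HodgeConjecture-24833`, route of record `HCCMUnconditional`; cell `hodgecm-mathlib`, R90-TF programme, section S8 «ContSpec-n½», socket B MID :358
∕ (V).  THEOREMS ONLY (no `def`, no `instance`, no `notation`, no named-fact hypothesis, no `sorry`; default heartbeats); lane `--supports stmt-HodgeConjecture-24833 --as helper`
(count-neutral).  CLOSES NO SOCKET (OF-RECORD ≠ payment).  ★ p865134 `resGMidBlock_ne_bot_of_record_v15` is called BY NAME with:
(00000000) NEW IN ED. 16 (S8-R254 «bind ★ p865115 `bV`»): `⟨ι', _, _, bV, Mb, hbc, hbM⟩ := exists_blockBasis_levelOfRecord L (ξ.bcη⁻¹·μω) (isUnitary_bcηInv_mul L ξ hμu) h𝔫` (★ p865115: finite dimension of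
`V(χʷ; K(𝔫), ω)` by the finite index of the level of record, continuity by the key lemma `omegaOfRecord χʷ 1 = omegaOfRecord χ 1`, bound by unitarity); the coordinate-sum `hsrc` of ED. 12–15
(`Σ_j Q_j(z)·bV_j(g₁)·Θ(g₁) = A(z)·cS(z)`) is now READ FROM the basis-free `hsrc` (`(∫_N f_z(w₀vg₁) dν)·H(g₁)^{z−2}·Θ(g₁) = A(z)·cS(z)`) through the exports' clause 2 at `g₁` (`Σ_j Q_j(z)•bV_j =
(ν𝓕)⁻¹•(∫_N f_z(w₀v·))·H^{z−2}`, `ν 𝓕 = 1`); GONE: `{ι'} [Fintype ι'] [DecidableEq ι'] bV hbc {Mb} hbM`; CHANGED: `hsrc` (basis-free, same content).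
(0000000) ED. 15 (S8-R252 «ED. 15 = `hMS32` DISCHARGED modulo the core»): `hMS32 := hMS32_midWitness_of_unfolding … h𝓕1 μK νI h𝓕I (isUnitary_bcηInv_mul L ξ hμu) (bcηInv_mul_posRealIdele L ξ μω hμω)
(isUnitary_bcηInv_mul L ξ hμu) (bcηInv_mul_posRealIdele L ξ μω hμω) (finite_ramifiedPlaces_holds _) (not_not.1 ·) isUnitary_one (fun _ => rfl) finite_empty (fun _ _ _ => rfl) hunfK` — the (MS-3∕2)
bound at the NAMED family from ★ p863403 `msBound_middlePole_of_chiRelation` with ALL FIVE of its letters now theorems: `hMSrel` letter-free (★ TUBE-FREE + agreements + ★ `msRel_of_tube_letters_at`),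
`hreal` (★ p864973), and the simple-pole data `hd hdw hβ` from ★ p864823's Euler factorisation `(z−2)(2z−3)·qc_j = G·a_j` on `{1<Re}∖P`; GONE: `hMS32` — NO new visible binder (`hunfK` was
already visible).  (000000) ED. 14: `hreal hρ₁ hφ1` bound by name (★ p864973, ★ NeBotAssembly §1).  Everything else is ED. 13 verbatim (see ★ p864963's docstring for (00000)–(3)).
VISIBLE → PAYER: `hunfK` ⇐ ★ p864886 `hunfK_of_core` ∘ the (W)-core's LOCAL READINGS (K2E1-p11 (g6) (a)–(e), K2E1-p14 (g5) (3b) ★ p864998, F0P2-p11 pure-tensor files ★ p865032 ∕ p865072) —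
ED. 17 binds when ★ and re-points `c_S`'s `S, T` (C133-p02's note); `hsrc` ⇐ ★ p864589's base-point head (`S₀ C hC` + `ε kμ δ d νv μE₁ μF₁` are its constants — K2E1-p13 (g6)'s
`exists_srcConstants_of_record`, ED. 17); `μK νI 𝓕I h𝓕I h𝓕1` frame plumbing (Haar measures, an idele-class domain, `ν 𝓕 = 1`); the witness `φ₀ hφ₀V hφ₀c hφ₀M` per J-S8-WIT′ (★ K2E1-p11).
HONEST LABEL: HC_CM is proved only modulo the 7 printed citations (2 remaining named inputs: hLiu418 = `stmt-HodgeConjecture-24832`, h413 = `stmt-HodgeConjecture-24833`) until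
rung 0 closes; OF-RECORD ≠ payment — :358 stays `sorry` in B until every visible row is ★ and instantiated; SOCKET DIGITS 0∕8; REL ≠ ★ ≠ WRITTEN ≠ BUILT; count-neutral.

## References
* [Rogawski1990] J. D. Rogawski, *Automorphic Representations of Unitary Groups in Three Variables* (1990), §13.3 p. 202, §13.9 (ii) p. 229, §12.1 p. 171.
* [MoeglinWaldspurger1995] C. Mœglin, J.-L. Waldspurger, *Spectral Decomposition and Eisenstein Series* (1995), I.2.17, IV.1.8–IV.1.11, IV.2.3, IV.3.12.
* [BernsteinLapid2019] J. Bernstein, E. Lapid, *On the meromorphic continuation of Eisenstein series*, J. Amer. Math. Soc. 37 (2024), Thm 2.3, §4.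
-/

set_option autoImplicit false
set_option linter.dupNamespace false  -- the mandated namespace `…HodgeConjecture.HodgeConjecture.R90.S8` (LEAD #1 L1) repeats the summit's segment

noncomputable section

open MeasureTheory Measure NumberField IsDedekindDomain Set Filter Topology Metric
open scoped ENNReal NNReal MatrixGroups
open Literature.MeasureTheory.Group Literature.NumberTheory
open Literature.NumberTheory.Automorphic Literature.NumberTheory.Automorphic.UnitaryGroup Literature.NumberTheory.LFunctions Literature.NumberTheory.GaloisRepresentations AdelicGroupData
open Literature.NumberTheory.Automorphic.Arthur2013.Leaves.TECR Literature.NumberTheory.Rogawski1990 ContRepresentation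
open Summit.HodgeConjecture.HodgeConjecture.Cruxes.H413.K2E1BorelEisensteinU
open Summit.HodgeConjecture.HodgeConjecture.Cruxes.H413.K2E1BLBorelSpacesU2Defs
open Summit.HodgeConjecture.HodgeConjecture.Cruxes.H413.K2E1BLBorelOperatorsU2Defs
open Summit.HodgeConjecture.HodgeConjecture.Cruxes.H413.K2E1CharacterEisensteinU2Defs
open Summit.HodgeConjecture.HodgeConjecture.Cruxes.H413.K2E1ChiSectionSpaceU2Defs
open Summit.HodgeConjecture.HodgeConjecture.Cruxes.H413.K2E1CharacterEisensteinU3PairDefs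
open Summit.HodgeConjecture.HodgeConjecture.Cruxes.H413.K2E1ChiSectionSpaceU3PairDefs
open Summit.HodgeConjecture.HodgeConjecture.Cruxes.H413.K2E1HeckeLHalfNeZeroDefs (LHalfNeZero)
open Summit.HodgeConjecture.HodgeConjecture.Cruxes.H413.K2E1ChiEisensteinLedgerLettersOfExportsCMThree (ledgerLetters_of_exports)
open Summit.HodgeConjecture.HodgeConjecture.Cruxes.H413.K2E1ChiArchA32ShiftedOfRecordU3 (hA32_shifted_of_record_at_basePoint_of_modEq)
open Summit.HodgeConjecture.HodgeConjecture.Cruxes.H413.K2E1ChiArchA32DifferentiableU3 (differentiableOn_amplitude_shifted_midBlock)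
open Summit.HodgeConjecture.HodgeConjecture.Cruxes.H413.K2E1ChiTruncatedFamilyTransportCMThree (hE6_midWitness)
open Summit.HodgeConjecture.HodgeConjecture.Cruxes.H413.K2E1ChiScatteringCoordsEulerFactorisationCMThree (exists_eulerFactorisation_midWitness hMSP'_midWitness_of_unfolding)
open Summit.HodgeConjecture.HodgeConjecture.Cruxes.H413.K2E1ChiConstantTermLedgerOfRecordCMThree (ctLedger_of_amplitudeRows_codiscrete)
open Summit.HodgeConjecture.HodgeConjecture.Cruxes.H413.K2E1ChiAmplitudeOfTranslateU3 (amplitudeOfTranslate amplitudeRows_of_coordFactorisation smul_apply_eq_sum_mul_of_sum_smul_eq)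
open Summit.HodgeConjecture.HodgeConjecture.Cruxes.H413.K2E1ChiEisensteinConstantTermCMThree (borelConstantTerm_chiPairEisenstein_cm_three_eq_add_mul)
open Summit.HodgeConjecture.HodgeConjecture.Cruxes.H413.K2E1ChiEisensteinMeromorphicExportsM1CMThree (one_apply_torus isAutomorphic_one)
open Summit.HodgeConjecture.HodgeConjecture.Cruxes.H413.K2E1ChiEisensteinDetTwistU2 (borelConstantTerm_mul_automorphicCharacter)
open Summit.HodgeConjecture.HodgeConjecture.Cruxes.H413.K2E1L2FamilyTwistU (exists_mulCLM_of_norm_le quotFun_mul)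
open Summit.HodgeConjecture.HodgeConjecture.Cruxes.H413.K2E1ChiEisensteinDetTwistU2 (truncation_mul_automorphicCharacter)
open Literature.NumberTheory.GaloisRepresentations.IsNonarchimedeanLocalField
open Literature.NumberTheory.Automorphic.UnitaryGroup.AdelicCharactersDetQuasiSplit (antidiagonal_over_det_ne_zero)
open scoped ComplexConjugate

open Summit.HodgeConjecture.HodgeConjecture.Cruxes.H413.K2E1ChiMS32OfUnfoldingCMThree (hMS32_midWitness_of_unfolding)


namespace Summit.HodgeConjecture.HodgeConjecture.R90.S8

variable (L : Type) [Field L] [NumberField L] [IsCMField L]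
  [MeasurableSpace (quasiSplit (↥(maximalRealSubfield L)) L (IsCMField.complexConj L) 3).Adelic] [BorelSpace (quasiSplit (↥(maximalRealSubfield L)) L (IsCMField.complexConj L) 3).Adelic]
  [MeasurableSpace (arch (↥(maximalRealSubfield L)) L (IsCMField.complexConj L) 3 ((StdForm.antidiagonal 3).over L))] [BorelSpace (arch (↥(maximalRealSubfield L)) L (IsCMField.complexConj L) 3 ((StdForm.antidiagonal 3).over L))]
  [MeasurableSpace (finAdelic (↥(maximalRealSubfield L)) L (IsCMField.complexConj L) 3 ((StdForm.antidiagonal 3).over L))] [BorelSpace (finAdelic (↥(maximalRealSubfield L)) L (IsCMField.complexConj L) 3 ((StdForm.antidiagonal 3).over L))]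
  [MeasurableSpace (AdeleRing (𝓞 L) L)ˣ] [BorelSpace (AdeleRing (𝓞 L) L)ˣ]  -- ED. 11: the idele frame of ★ `hMSP'_midWitness_of_coordLetters`


/-! ## The edition -/

/-- **(V) OF RECORD, ED. 16 — `LHalfNeZero (ξ.bcη⁻¹·μω) → resGMidBlock L μ ξ μω ≠ ⊥` AT THE PRINCIPAL CONGRUENCE LEVEL `K(𝔫)`**: ★ p865134 `resGMidBlock_ne_bot_of_record_v15` with the
basis `bV hbc hbM` := ★ `exists_blockBasis_levelOfRecord` (p865115) chosen inside the proof and `hsrc` BASIS-FREE (its coordinate form recovered from the exports' clause 2 at `g₁`); the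
remaining visible binders are ED. 15's minus the basis (`hunfK`, frame extras, witness, `g₁`, `hsrc` + its constants). [cite: Rogawski1990, §13.9 (ii) p. 229]
[cite: MoeglinWaldspurger1995, IV.1.11, IV.2.3, IV.3.12] [cite: BernsteinLapid2019, Thm 2.3, §4] -/
theorem resGMidBlock_ne_bot_of_record_v16
    (μ : Measure (quasiSplit (↥(maximalRealSubfield L)) L (IsCMField.complexConj L) 3).automorphicQuotient) [(quasiSplit (↥(maximalRealSubfield L)) L (IsCMField.complexConj L) 3).IsAutomorphicMeasure μ]
    (μω : HeckeCharacter L) (hμu : μω.IsUnitary)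
    (hμω : ∀ x : ideleGroup ↥(maximalRealSubfield L), μω (AdeleRing.ideleBaseChange (↥(maximalRealSubfield L)) L x) = quadraticHeckeCharCM L x)
    (ξ : OneDimAutRepH L)
    -- the exports' structural data (Haar measures, fundamental domain, covering weight, CM frame facts)
    (νG : Measure (quasiSplit (↥(maximalRealSubfield L)) L (IsCMField.complexConj L) 3).Adelic) [νG.IsHaarMeasure] [νG.IsInvInvariant] [SFinite νG]
    (ν : Measure ↥(adelicUnipotent (↥(maximalRealSubfield L)) L (IsCMField.complexConj L) 3)) [ν.IsHaarMeasure] [ν.IsMulRightInvariant] [ν.IsInvInvariant]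
    {𝓕 : Set ↥(adelicUnipotent (↥(maximalRealSubfield L)) L (IsCMField.complexConj L) 3)}
    (h𝓕N : IsFundamentalDomain ↥(rationalUnipotent (↥(maximalRealSubfield L)) L (IsCMField.complexConj L) 3) 𝓕 ν) (h𝓕c : IsCompact (closure 𝓕)) (h𝓕₀ : ν 𝓕 ≠ 0)
    {β : (quasiSplit (↥(maximalRealSubfield L)) L (IsCMField.complexConj L) 3).Adelic → ℝ≥0∞}
    (hβ : IsCoveringWeight ↥((arithmeticBorel (↥(maximalRealSubfield L)) L (IsCMField.complexConj L) 3).map (quasiSplit (↥(maximalRealSubfield L)) L (IsCMField.complexConj L) 3).arithmeticSubgroup.subtype) β)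
    {μZ : Measure (borelQuotient (↥(maximalRealSubfield L)) L (IsCMField.complexConj L) 3)} [SFinite μZ]
    (hμZ : ∀ f : borelQuotient (↥(maximalRealSubfield L)) L (IsCMField.complexConj L) 3 → ℝ≥0∞, Measurable f → ∫⁻ z, f z ∂μZ = ∫⁻ g, β g * f (toBorelQuotient (↥(maximalRealSubfield L)) L (IsCMField.complexConj L) 3 g) ∂νG)
    (μa : Measure (arch (↥(maximalRealSubfield L)) L (IsCMField.complexConj L) 3 ((StdForm.antidiagonal 3).over L))) [μa.IsHaarMeasure] [μa.IsMulRightInvariant]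
    (μf : Measure (finAdelic (↥(maximalRealSubfield L)) L (IsCMField.complexConj L) 3 ((StdForm.antidiagonal 3).over L))) [μf.IsHaarMeasure]
    (h2 : Module.finrank (↥(maximalRealSubfield L)) L = 2) (hc : IsCMField.complexConj L ≠ 1)
    -- (i) THE LEVEL OF RECORD `K(𝔫)` BY NAME, `𝔫 ≠ 0` (K2E1-p11 ★ p863976 ∕ p864091 ∕ p864141; `K_f := finCongruenceLevel 𝔫`, `U₀ := K_f(𝔫) ≤ GL₃(𝔸_f)` open compact ★ Ash–Smith): `K′ := levelOfRecord K(𝔫)_f`, `ω₀ := omegaOfRecord χ 1 K(𝔫)_f`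
    (𝔫 : Ideal (𝓞 L)) (h𝔫 : 𝔫 ≠ 0)
    -- (i) THE WITNESS AS BINDERS (J-S8-WIT′): `φ₀ ∈ V(ξ.bcη⁻¹·μω; levelOfRecord K_f, omegaOfRecord … 1 K_f)`, continuous, `‖φ₀‖ ≤ 1` (`Mφ := 1`)
    {φ₀ : (quasiSplit (↥(maximalRealSubfield L)) L (IsCMField.complexConj L) 3).Adelic → ℂ} (hφ₀V : φ₀ ∈ chiSectionSpace (ξ.bcη⁻¹ * μω) (levelOfRecord L (finCongruenceLevel (↥(maximalRealSubfield L)) L (IsCMField.complexConj L) 3 ((StdForm.antidiagonal 3).over L) 𝔫)) (omegaOfRecord L (ξ.bcη⁻¹ * μω) (1 : ↥(TorusDict.torus (IsCMField.complexConj L)) →ₜ* ℂˣ) (finCongruenceLevel (↥(maximalRealSubfield L)) L (IsCMField.complexConj L) 3 ((StdForm.antidiagonal 3).over L) 𝔫))) (hφ₀c : Continuous φ₀) (hφ₀M : ∀ x, ‖φ₀ x‖ ≤ 1)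
    -- (i) VISIBLE: TWO LETTERS about the NAMED UNTWISTED family `midWitnessEc` off the NAMED `midWitnessP` ((E6) `hE6` is ★ `hE6_midWitness` since ED. 10; ★ `ledgerLetters_of_exports` turns the three into ★ p864046's `hbddPK hbdd32` for `midWitnessEc·Θ`)
    -- (i) ED. 14–16: `hMSP′` ★, `hMS32` ★, the basis `bV` ★ p865115 (chosen inside the proof) — only the Maass–Selberg frame extras stay visible (`hqa` PAID by ★ p864823 from `hunfK` below)
    (μK : Measure ((standardMaximalCompactGL 3 L).comap (adelicVal (↥(maximalRealSubfield L)) L (IsCMField.complexConj L) 3 ((StdForm.antidiagonal 3).over L)) : Subgroup (quasiSplit (↥(maximalRealSubfield L)) L (IsCMField.complexConj L) 3).Adelic)) [μK.IsHaarMeasure]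
    (νI : Measure (AdeleRing (𝓞 L) L)ˣ) [νI.IsHaarMeasure]
    {𝓕I : Set (AdeleRing (𝓞 L) L)ˣ} (h𝓕I : IsIdeleClassDomain L 𝓕I) (h𝓕1 : ν 𝓕 = 1)
    -- (ii) ED. 12∕13: ROW (ii) IS BOUND (§1 `rowTwo_of_coordRoad`) and the Euler factorisation is ★ p864823; visible: the BASE POINT `g₁`, `φ ≠ 1`, and THE ONE UNFOLDING LETTER `hunfK` (K2E2-p12 (g10)'s bytes)
    (g₁ : (quasiSplit (↥(maximalRealSubfield L)) L (IsCMField.complexConj L) 3).Adelic)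
    (hunfK : ∀ k : (quasiSplit (↥(maximalRealSubfield L)) L (IsCMField.complexConj L) 3).Adelic, adelicVal (↥(maximalRealSubfield L)) L (IsCMField.complexConj L) 3 ((StdForm.antidiagonal 3).over L) k ∈ standardMaximalCompactGL 3 L →
      ∃ A : ℂ → ℂ, DifferentiableOn ℂ A {z : ℂ | 1 < z.re} ∧ ∀ z : ℂ, 2 < z.re →
        (∫ v : ↥(adelicUnipotent (↥(maximalRealSubfield L)) L (IsCMField.complexConj L) 3), flatSectionU φ₀ z (((quasiSplit (↥(maximalRealSubfield L)) L (IsCMField.complexConj L) 3).toAdelic (weylLongU ((IsCMField.complexConj L : L ≃ₐ[↥(maximalRealSubfield L)] L) : L →+* L) (rfl : (StdForm.antidiagonal 3).over L = (StdForm.antidiagonal 3).over L))) * ((v : (quasiSplit (↥(maximalRealSubfield L)) L (IsCMField.complexConj L) 3).Adelic) * k)) ∂ν) =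
          ((partialStandardL (ξ.bcη⁻¹ * μω).ramifiedPlaces (fun w => {(ξ.bcη⁻¹ * μω).valueAtUniformizer w}) (z - 1) * partialStandardL (∅ : Set (HeightOneSpectrum (𝓞 ↥(maximalRealSubfield L)))) (fun v => {(1 : HeckeCharacter ↥(maximalRealSubfield L)).valueAtUniformizer v}) (2 * z - 2)) /
            (partialStandardL (ξ.bcη⁻¹ * μω).ramifiedPlaces (fun w => {(ξ.bcη⁻¹ * μω).valueAtUniformizer w}) z * partialStandardL (∅ : Set (HeightOneSpectrum (𝓞 ↥(maximalRealSubfield L)))) (fun v => {(1 : HeckeCharacter ↥(maximalRealSubfield L)).valueAtUniformizer v}) (2 * z - 1))) * A z)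
    -- (iii) ★ p864046's row (iii): the ramification data is BOUND BY NAME in ED. 9 (`S := (ξ.bcη⁻¹·μω).ramifiedPlaces`, `T′ := ∅`); the NAMED `A` (below)
    -- (iii) `A` FULLY NAMED AT THE MID-BLOCK TABLE `m_w = kμ,w − 2·ξ.eη w` (★ p864366 + K2E1-p13's ★ `shiftExponents_spec`; visible: the parity `hk` of `kμ`): `A z := (C·∏_{v∈S₀} ν_v(𝒪_v³)⁻¹ • ∫ 𝟙_{B_v(𝔫)}·Q_v^{−z}) · ∫∫ (∏_w ε_w·archUnitaryValue m_w 0 ζ_w·((2+ζ_w)∕ζ_w)^{p_w}·((2+conj ζ_w)∕conj ζ_w)^{q_w})·ARCH₃^{−z}`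
    {δ : L} (hcδ : IsCMField.complexConj L δ = -δ) (hδ : δ ≠ 0) {d : ↥(maximalRealSubfield L)} (hd : δ * δ = algebraMap ↥(maximalRealSubfield L) L d)
    [∀ v : HeightOneSpectrum (𝓞 ↥(maximalRealSubfield L)), MeasurableSpace (v.adicCompletion ↥(maximalRealSubfield L))] [∀ v : HeightOneSpectrum (𝓞 ↥(maximalRealSubfield L)), BorelSpace (v.adicCompletion ↥(maximalRealSubfield L))]
    (νv : ∀ v : HeightOneSpectrum (𝓞 ↥(maximalRealSubfield L)), Measure (v.adicCompletion ↥(maximalRealSubfield L))) [∀ v, (νv v).IsAddHaarMeasure]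
    [MeasurableSpace (InfiniteAdeleRing L)] [BorelSpace (InfiniteAdeleRing L)]
    [MeasurableSpace (InfiniteAdeleRing ↥(maximalRealSubfield L))] [BorelSpace (InfiniteAdeleRing ↥(maximalRealSubfield L))]
    (μE₁ : Measure (InfiniteAdeleRing L)) [μE₁.IsAddHaarMeasure] (μF₁ : Measure (InfiniteAdeleRing ↥(maximalRealSubfield L))) [μF₁.IsAddHaarMeasure]
    (ε : InfinitePlace L → ℂ) (hε1 : ∀ w, ‖ε w‖ ≤ 1) (hε0 : ∀ w, ε w ≠ 0)
    (kμ : InfinitePlace L → ℤ) (hk : ∀ w, Int.ModEq 2 (kμ w) 1)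
    (S₀ : Finset (HeightOneSpectrum (𝓞 ↥(maximalRealSubfield L)))) {C : ℂ} (hC : C ≠ 0)
    -- (`hA` — holomorphy of the named `A` on `{1 < Re}` — is ★ `differentiableOn_amplitude_shifted_midBlock`, bound by name in the proof; it costs the binders `{d} (hd)`: `δ² ∈ L⁺`)
    (hsrc : ∀ z : ℂ, 2 < z.re → (∫ v : ↥(adelicUnipotent (↥(maximalRealSubfield L)) L (IsCMField.complexConj L) 3), flatSectionU φ₀ z ((quasiSplit (↥(maximalRealSubfield L)) L (IsCMField.complexConj L) 3).toAdelic (weylLongU ((IsCMField.complexConj L : L ≃ₐ[↥(maximalRealSubfield L)] L) : L →+* L) (rfl : (StdForm.antidiagonal 3).over L = (StdForm.antidiagonal 3).over L)) * ((v : (quasiSplit (↥(maximalRealSubfield L)) L (IsCMField.complexConj L) 3).Adelic) * g₁)) ∂ν) * (((borelHeight g₁ : ℝ) : ℂ) ^ (z - 2)) *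
        (((detChar (↥(maximalRealSubfield L)) L (IsCMField.complexConj L) h2 hc 3 ((StdForm.antidiagonal 3).over L) ξ.ψ ξ.hψ (antidiagonal_over_det_ne_zero L 3)) g₁ : ℂˣ) : ℂ) = (fun z : ℂ => (C * ∏ v ∈ S₀, ((Measure.pi fun _ : Fin 3 => νv v) (integralBox ↥(maximalRealSubfield L) (Fin 3) v)).toReal⁻¹ •
              ∫ p : Fin 3 → v.adicCompletion ↥(maximalRealSubfield L),
                Set.indicator {p : Fin 3 → v.adicCompletion ↥(maximalRealSubfield L) | p ∈ integralBox ↥(maximalRealSubfield L) (Fin 3) v ∧ ∀ w' : PlacesOver L v,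
                    Valued.v (quadraticLocalEquiv L v (IsCMField.complexConj L) hcδ hδ (p 0, p 1) w') ≤ idealRadius L w'.1 𝔫 ∧
                    Valued.v (conjLocal L (IsCMField.complexConj L) v (quadraticLocalEquiv L v (IsCMField.complexConj L) hcδ hδ (p 0, p 1)) w') ≤ idealRadius L w'.1 𝔫 ∧
                    Valued.v ((toLocalRing L v (p 2) * algebraMap L (LocalRing L v) δ -
                      toLocalRing L v 2⁻¹ * (quadraticLocalEquiv L v (IsCMField.complexConj L) hcδ hδ (p 0, p 1) * conjLocal L (IsCMField.complexConj L) v (quadraticLocalEquiv L v (IsCMField.complexConj L) hcδ hδ (p 0, p 1)))) w') ≤ idealRadius L w'.1 𝔫}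
                  (fun _ => (1 : ℂ)) p *
                (((∏ w' : PlacesOver L v, max 1 (max ((normAbs (w'.1.adicCompletion L) (quadraticLocalEquiv L v (IsCMField.complexConj L) hcδ hδ (p 0, p 1) w') : ℝ≥0) : ℝ)
                  ((normAbs (w'.1.adicCompletion L) ((toLocalRing L v (p 2) * algebraMap L (LocalRing L v) δ -
                    toLocalRing L v 2⁻¹ * (quadraticLocalEquiv L v (IsCMField.complexConj L) hcδ hδ (p 0, p 1) *
                      conjLocal L (IsCMField.complexConj L) v (quadraticLocalEquiv L v (IsCMField.complexConj L) hcδ hδ (p 0, p 1)))) w') : ℝ≥0) : ℝ))) : ℝ) : ℂ) ^ (-z) ∂(Measure.pi fun _ : Fin 3 => νv v)) *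
            ∫ Xi : InfiniteAdeleRing L, ∫ a : InfiniteAdeleRing ↥(maximalRealSubfield L),
            (∏ w : InfinitePlace L, ε w * archUnitaryValue (kμ w - 2 * ξ.eη w) 0 ((((-(1 + ‖Xi w‖ ^ 2 / 2)) : ℝ) : ℂ) + (((w.embedding δ).im * ((InfiniteAdeleRing.ringEquiv_mixedSpace ↥(maximalRealSubfield L)) a).1 ⟨w.comap (algebraMap ↥(maximalRealSubfield L) L), Summit.HodgeConjecture.HodgeConjecture.Cruxes.H413.K2E1HeightBigCellLineFormulaU2.isReal_comap_maximalRealSubfield L w⟩ : ℝ) : ℂ) * Complex.I) * (((2 : ℂ) + ((((-(1 + ‖Xi w‖ ^ 2 / 2)) : ℝ) : ℂ) + (((w.embedding δ).im * ((InfiniteAdeleRing.ringEquiv_mixedSpace ↥(maximalRealSubfield L)) a).1 ⟨w.comap (algebraMap ↥(maximalRealSubfield L) L), Summit.HodgeConjecture.HodgeConjecture.Cruxes.H413.K2E1HeightBigCellLineFormulaU2.isReal_comap_maximalRealSubfield L w⟩ : ℝ) : ℂ) * Complex.I)) / ((((-(1 + ‖Xi w‖ ^ 2 / 2)) : ℝ)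 : ℂ) + (((w.embedding δ).im * ((InfiniteAdeleRing.ringEquiv_mixedSpace ↥(maximalRealSubfield L)) a).1 ⟨w.comap (algebraMap ↥(maximalRealSubfield L) L), Summit.HodgeConjecture.HodgeConjecture.Cruxes.H413.K2E1HeightBigCellLineFormulaU2.isReal_comap_maximalRealSubfield L w⟩ : ℝ) : ℂ) * Complex.I)) ^ (((kμ w - 2 * ξ.eη w) - 1) / 2).toNat * (((2 : ℂ) + conj ((((-(1 + ‖Xi w‖ ^ 2 / 2)) : ℝ) : ℂ) + (((w.embedding δ).im * ((InfiniteAdeleRing.ringEquiv_mixedSpace ↥(maximalRealSubfield L)) a).1 ⟨w.comap (algebraMap ↥(maximalRealSubfield L) L), Summit.HodgeConjecture.HodgeConjecture.Cruxes.H413.K2E1HeightBigCellLineFormulaU2.isReal_comap_maximalRealSubfield L w⟩ : ℝ) : ℂ) * Complex.I)) / conj ((((-(1 + ‖Xi w‖ ^ 2 / 2)) : ℝ) : ℂ) + (((w.embedding δ).im * ((InfiniteAdeleRing.ringEquiv_mixedSpace ↥(maximalRealSubfield L)) a).1 ⟨w.comap (algebraMap ↥(maximalRealSubfield L) L), Summit.HodgeConjecture.HodgeConjecture.Cruxes.H413.K2E1HeightBigCellLineFormulaU2.isReal_comap_maximalRealSubfield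 L w⟩ : ℝ) : ℂ) * Complex.I)) ^ ((-(kμ w - 2 * ξ.eη w) - 1) / 2).toNat) *
              ((((∏ w : InfinitePlace L, ((1 + ‖(Xi) w‖ ^ 2 / 2) ^ 2 + (w δ) ^ 2 * (((InfiniteAdeleRing.ringEquiv_mixedSpace ↥(maximalRealSubfield L)) a).1 ⟨w.comap (algebraMap ↥(maximalRealSubfield L) L), Summit.HodgeConjecture.HodgeConjecture.Cruxes.H413.K2E1HeightBigCellLineFormulaU2.isReal_comap_maximalRealSubfield L w⟩) ^ 2))) : ℝ) : ℂ) ^ (-z) ∂μF₁ ∂μE₁) z *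
          ((partialStandardL (ξ.bcη⁻¹ * μω).ramifiedPlaces (fun w => {(ξ.bcη⁻¹ * μω).valueAtUniformizer w}) (z - 1) * partialStandardL (∅ : Set (HeightOneSpectrum (𝓞 ↥(maximalRealSubfield L)))) (fun v => {(1 : HeckeCharacter ↥(maximalRealSubfield L)).valueAtUniformizer v}) (2 * z - 2)) /
            (partialStandardL (ξ.bcη⁻¹ * μω).ramifiedPlaces (fun w => {(ξ.bcη⁻¹ * μω).valueAtUniformizer w}) z * partialStandardL (∅ : Set (HeightOneSpectrum (𝓞 ↥(maximalRealSubfield L)))) (fun v => {(1 : HeckeCharacter ↥(maximalRealSubfield L)).valueAtUniformizer v}) (2 * z - 1)))) :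
    LHalfNeZero (ξ.bcη⁻¹ * μω) → resGMidBlock L μ ξ μω ≠ ⊥ := by
  -- the continuous bounded basis of the reflected level-of-record block (★ p865115), chosen here
  obtain ⟨ι', hι, hdec, bV, Mb, hbc, hbM⟩ := exists_blockBasis_levelOfRecord L (ξ.bcη⁻¹ * μω) (isUnitary_bcηInv_mul L ξ hμu) h𝔫
  -- the exports' clause 2 (the coordinate identity) at the base point reads the basis-free `hsrc` in ED. 15's coordinates
  obtain ⟨-, hqφ, -⟩ := midWitnessExports_spec L μ νG ν h𝓕N h𝓕c h𝓕₀ hβ hμZ hφ₀V hφ₀c hφ₀M (levelOfRecord_le L (finCongruenceLevel (↥(maximalRealSubfield L)) L (IsCMField.complexConj L) 3 ((StdForm.antidiagonal 3).over L) 𝔫)) (archToAdelic_mem_levelOfRecord L (finCongruenceLevel (↥(maximalRealSubfield L)) L (IsCMField.complexConj L) 3 ((StdForm.antidiagonal 3).over L) 𝔫)) ((principalCongruenceLevel 3 L 𝔫).comap (GLn.ofFinite 3 L)) (isOpen_comap_ofFinite_principalCongruenceLevel 3 L h𝔫) (isCompact_comap_ofFinite_principalCongruenceLevel 3 L h𝔫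)
    (fun _ hb => exists_mem_levelOfRecord_omegaOfRecord_eq_one L (ξ.bcη⁻¹ * μω) (1 : ↥(TorusDict.torus (IsCMField.complexConj L)) →ₜ* ℂˣ) (finCongruenceLevel_le_integralLevel (↥(maximalRealSubfield L)) L (IsCMField.complexConj L) 3 ((StdForm.antidiagonal 3).over L) 𝔫) hb)
    (fun _ hφ => continuous_of_mem_chiSectionSpace_levelOfRecord L (ξ.bcη⁻¹ * μω) (finCongruenceLevel_le_integralLevel (↥(maximalRealSubfield L)) L (IsCMField.complexConj L) 3 ((StdForm.antidiagonal 3).over L) 𝔫) (isOpen_finCongruenceLevel (↥(maximalRealSubfield L)) L (IsCMField.complexConj L) 3 ((StdForm.antidiagonal 3).over L) h𝔫) hφ)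
    μa μf bV hbc hbM h2 hc (antidiagonal_over_det_ne_zero L 3) ξ.ψ ξ.hψ
  refine resGMidBlock_ne_bot_of_record_v15 L μ μω hμu hμω ξ νG ν h𝓕N h𝓕c h𝓕₀ hβ hμZ μa μf h2 hc 𝔫 h𝔫 hφ₀V hφ₀c hφ₀M bV hbc hbM μK νI h𝓕I h𝓕1 g₁ hunfK hcδ hδ hd νv μE₁ μF₁ ε hε1 hε0 kμ hk S₀ hC
    fun z hz => ?_
  have h := congrFun (hqφ z hz) g₁
  rw [h𝓕1, ENNReal.toReal_one, inv_one, Complex.ofReal_one, one_smul, Finset.sum_apply] at h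
  simp only [Pi.smul_apply, smul_eq_mul] at h
  rw [← hsrc z hz, ← h, Finset.sum_mul]
  exact Finset.sum_congr rfl fun j _ => by ring

end Summit.HodgeConjecture.HodgeConjecture.R90.S8

end
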